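import Literature.Geometry.Lorentzian.OpensCausality
import Literature.Geometry.Lorentzian.KerrData
import Literature.Geometry.Lorentzian.KerrTimelikeSpan
import Literature.Geometry.Lorentzian.KerrAxialSymmetry
import HarnessLib

set_option linter.dupNamespace false

/-!
# Stub `stub_kerrHelix` of line `swallow-transfer`, crux `EIHFluxBalance.ModulatedKerrHandoff` (stmt-FinalStateConjecture-10167)

Support file for crux `stmt-FinalStateConjecture-10167`
(`Summit.FinalStateConjecture.FinalStateConjecture.Theses.EIHFluxBalance.ModulatedKerrHandoff`), line
`swallow-transfer`: the registered stub `stub_kerrHelix` (statement VERBATIM from the registered skeleton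
`Cruxes/ModulatedKerrHandoff/Lines/swallow_transfer.lean`).

**The DRSR helix.** On sub-extremal Kerr (`|a| < M`), in the ingoing Kerr–Schild chart `Kerr.region a r₁`,
through every point `p` with `r(p) > r₊` passes the explicit curve
`γ(s) = R_z(ω s) p + s ∂_{t*}`, `ω = 2Mar/(r² + a²)²` at `r = r(p)` (`Kerr.drsrAngularVelocity`), `R_z` the
rotation about the `x₃`-axis (`E4.axialRotation`). Rotations about the axis and `t*`-translations preserve the
Kerr–Schild radius, so `r(γ s) = r(p)` and `γ` stays in the chart; its lab time is `p⁰ + s`; its velocity is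
the DRSR vector `V = ∂₀ + ω(r)(x₁∂₂ − x₂∂₁)` (`Kerr.drsrVector`) at `γ s`, which is timelike off the horizon
(Dafermos–Rodnianski–Shlapentokh-Rothman, arXiv:1402.7034, Lemma 4.7.1; `Kerr.bilin_drsrVector_neg`) and
future-directed for the Kerr time orientation `−g♯(dt*)` (`g(−g♯dt*, V) = −V⁰ = −1`, `Kerr.bilin_timeVector`).

References: Dafermos–Rodnianski–Shlapentokh-Rothman arXiv:1402.7034, Lemma 4.7.1; O'Neill 1995, Ch. 2, §2.2
(the Killing fields `∂_t`, `∂_φ`); O'Neill 1983, Ch. 1, pp. 3–7 (open submanifolds), Ch. 5, p. 146.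
-/

noncomputable section

open scoped Manifold ContDiff Topology
open Set Literature.Geometry.Lorentzian

namespace Summit.FinalStateConjecture.FinalStateConjecture.Cruxes.ModulatedKerrHandoff.SwallowTransfer

/-! ## The coordinate helix `s ↦ R_z(w s) p + s ∂_{t*}` -/

/-- The Kerr–Schild radius is invariant under `t*`-translations (it depends on `‖x⃗‖` and `x₃` only;
Visser arXiv:0706.0622, (35)). [folklore] -/
theorem radius_add_smul_basisVector_zero (a : ℝ) (x : E4) (t : ℝ) :
    Kerr.radius a (x + t • E4.basisVector 0) = Kerr.radius a x := by
  have h3 : (x + t • E4.basisVector 0) 3 = x 3 := by simp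
  have hsp : E4.spatial (x + t • E4.basisVector 0) = E4.spatial x := by
    ext i
    simp [E4.spatial_apply]
  have hs : E4.spatialNorm (x + t • E4.basisVector 0) = E4.spatialNorm x := by
    simp only [E4.spatialNorm, hsp]
  simp only [Kerr.radius, hs, h3]

/-- The Kerr–Schild radius is constant along the coordinate helix `s ↦ R_z(w s) p + s ∂_{t*}` (rotations about
the axis and `t*`-translations preserve it). [folklore] -/
theorem radius_helix (a w : ℝ) (p : E4) (s : ℝ) :
    Kerr.radius a (E4.axialRotation (w * s) p + s • E4.basisVector 0) = Kerr.radius a p := by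
  rw [radius_add_smul_basisVector_zero, Kerr.radius_axialRotation]

/-- The axial vector `x₁ ∂₂ − x₂ ∂₁` is invariant under `t*`-translations. [folklore] -/
theorem axialVector_add_smul_basisVector_zero (x : E4) (t : ℝ) :
    Kerr.axialVector (x + t • E4.basisVector 0) = Kerr.axialVector x := by
  simp [Kerr.axialVector]

/-- **The axial Killing field is the velocity of the rotations** at every angle:
`d/dα R_α x = Φ(R_α x)` (the orbit is affine in `(cos α, sin α)`:
`R_α x = x + (cos α − 1)(x₁ ∂₁ + x₂ ∂₂) + sin α · Φ(x)`). O'Neill 1995, Ch. 2, §2.2. [folklore] -/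
theorem hasDerivAt_axialRotation_at (x : E4) (α : ℝ) :
    HasDerivAt (fun β : ℝ ↦ E4.axialRotation β x) (Kerr.axialVector (E4.axialRotation α x)) α := by
  set u : E4 := (x 1) • E4.basisVector 1 + (x 2) • E4.basisVector 2 with hu
  set v : E4 := Kerr.axialVector x with hv
  have heq : ∀ β : ℝ, E4.axialRotation β x = x + ((Real.cos β - 1) • u + Real.sin β • v) := fun β ↦ by
    ext i
    fin_cases i <;> simp [hu, hv, Kerr.axialVector, E4.basisVector] <;> ring
  have h1 : HasDerivAt (fun β : ℝ ↦ (Real.cos β - 1) • u) ((-Real.sin α) • u) α :=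
    ((Real.hasDerivAt_cos α).sub_const 1).smul_const u
  have h2 : HasDerivAt (fun β : ℝ ↦ Real.sin β • v) (Real.cos α • v) α :=
    (Real.hasDerivAt_sin α).smul_const v
  have h := (h1.add h2).const_add x
  have hval : (-Real.sin α) • u + Real.cos α • v = Kerr.axialVector (E4.axialRotation α x) := by
    ext i
    fin_cases i <;> simp [hu, hv, Kerr.axialVector, E4.basisVector] <;> ring
  rw [← hval]
  exact h.congr_of_eventuallyEq (Filter.Eventually.of_forall fun β ↦ heq β)

/-- **The helix is an integral curve of `∂₀ + w Φ`:** `d/ds (R_z(w s) p + s ∂₀) = ∂₀ + w Φ(R_z(w s) p + s ∂₀)`.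
[folklore] -/
theorem hasDerivAt_helix (w : ℝ) (p : E4) (s : ℝ) :
    HasDerivAt (fun σ : ℝ ↦ E4.axialRotation (w * σ) p + σ • E4.basisVector 0)
      (E4.basisVector 0 + w • Kerr.axialVector (E4.axialRotation (w * s) p + s • E4.basisVector 0)) s := by
  have h1 : HasDerivAt (fun σ : ℝ ↦ w * σ) w s := by
    simpa using (hasDerivAt_id s).const_mul w
  have h2 : HasDerivAt (fun σ : ℝ ↦ E4.axialRotation (w * σ) p)
      (w • Kerr.axialVector (E4.axialRotation (w * s) p)) s :=
    (hasDerivAt_axialRotation_at p (w * s)).scomp (h := fun σ : ℝ ↦ w * σ) s h1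
  have h3 : HasDerivAt (fun σ : ℝ ↦ σ • E4.basisVector 0) ((1 : ℝ) • E4.basisVector 0) s :=
    (hasDerivAt_id s).smul_const _
  have h := h2.add h3
  rw [one_smul] at h
  rw [axialVector_add_smul_basisVector_zero, add_comm (E4.basisVector 0)]
  exact h

/-- With `w = ω(r(p)) = 2Mar/(r² + a²)²` the velocity of the helix is the DRSR vector `Kerr.drsrVector M a` at the
point (the radius is constant along the helix). [cite: DafermosRodnianskiShlapentokhrothman2014, Lemma 4.7.1] -/
theorem hasDerivAt_helix_drsrVector (M a : ℝ) (p : E4) (s : ℝ) :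
    HasDerivAt (fun σ : ℝ ↦
        E4.axialRotation (Kerr.drsrAngularVelocity M a (Kerr.radius a p) * σ) p + σ • E4.basisVector 0)
      (Kerr.drsrVector M a
        (E4.axialRotation (Kerr.drsrAngularVelocity M a (Kerr.radius a p) * s) p + s • E4.basisVector 0)) s := by
  rw [Kerr.drsrVector, radius_helix]
  exact hasDerivAt_helix _ p s

/-- The chart velocity of a curve in the Kerr–Schild chart is the derivative of its coordinate expression
(`d(Subtype.val) = id`). [folklore] -/
theorem velocity_eq_deriv {a r₁ : ℝ} (γ : ℝ → Kerr.region a r₁) (t : ℝ) :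
    (velocity 𝓘(ℝ, E4) γ t : E4) = deriv (fun σ => (γ σ : E4)) t := by
  rw [← velocity_subtypeVal_comp (I := 𝓘(ℝ, E4)) (Kerr.region a r₁) γ t]
  unfold velocity
  rw [mfderiv_eq_fderiv]
  rfl

/-- **T4 `stub_kerrHelix`.** On sub-extremal Kerr, through every point `p` of the chart with `r(p) > r₊` passes the
explicit curve `γ(s) = (p⁰ + s, R_z(ω s) p̲)`, `ω = 2Mar/(r² + a²)²` (`Kerr.drsrAngularVelocity M a (r p)`), `R_z` the
rotation about the `x₃`-axis: it stays at the Kerr radius of `p` (rotations about the axis and time translations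
preserve `Kerr.radius`), its lab time is `p⁰ + s`, and it is a smooth future-directed timelike curve for all `s`
(velocity `= Kerr.drsrVector M a (γ s)`, timelike by `Kerr.bilin_drsrVector_neg` (DRSR arXiv:1402.7034 Lemma 4.7.1),
future-directed since `g(V, v) = −v⁰ = −1 < 0` for `V = Kerr.timeVector`, `Kerr.bilin_timeVector`; manifold plumbing
as in `Theorems/SwallowTheDatumKerrShieldedSettlesStubCollarCauchy.lean`, `velocity_eq_deriv`). Size S–M. -/
theorem stub_kerrHelix : ∀ [Kerr.Facts] (M a r₁ : ℝ) (hM : 0 ≤ M), |a| < M →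
    ∀ p : Kerr.region a r₁, Kerr.rPlus M a < Kerr.radius a (p : E4) →
      ∃ γ : ℝ → Kerr.region a r₁, γ 0 = p ∧ (∀ s : ℝ, (γ s : E4) 0 = (p : E4) 0 + s) ∧
        (∀ s : ℝ, Kerr.radius a (γ s : E4) = Kerr.radius a (p : E4)) ∧
        (Kerr.smoothMetric M a r₁).IsFutureTimelikeCurveOn
          ((Kerr.timeOrientation M a r₁ hM).ofLE le_top) γ Set.univ := by
  intro _ M a r₁ hM ha p hp
  set w : ℝ := Kerr.drsrAngularVelocity M a (Kerr.radius a (p : E4)) with hw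
  have hmem : ∀ s : ℝ, E4.axialRotation (w * s) p + s • E4.basisVector 0 ∈ Kerr.region a r₁ := fun s ↦ by
    rw [Kerr.mem_region, radius_helix]
    exact p.2
  set γ : ℝ → Kerr.region a r₁ := fun s ↦ ⟨E4.axialRotation (w * s) p + s • E4.basisVector 0, hmem s⟩ with hγ
  refine ⟨γ, Subtype.ext (by simp [hγ]), fun s ↦ by simp [hγ], fun s ↦ radius_helix a w p s, ?_⟩
  intro s _
  have hd : HasDerivAt (fun σ ↦ (γ σ : E4)) (Kerr.drsrVector M a (γ s)) s :=
    hasDerivAt_helix_drsrVector M a p s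
  have hmd : MDifferentiableAt 𝓘(ℝ, ℝ) 𝓘(ℝ, E4) γ s :=
    (mdifferentiableAt_subtypeVal_comp_curve_iff (I := 𝓘(ℝ, E4)) (Kerr.region a r₁)).1
      (mdifferentiableAt_iff_differentiableAt.2 hd.differentiableAt)
  have hv : (velocity 𝓘(ℝ, E4) γ s : E4) = Kerr.drsrVector M a (γ s) := by
    rw [velocity_eq_deriv, hd.deriv]
  have hx : 0 < Kerr.radius a (γ s) := Kerr.radius_pos_of_mem_region (γ s).2
  have hrad : Kerr.rPlus M a < Kerr.radius a (γ s : E4) := by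
    change Kerr.rPlus M a < Kerr.radius a (E4.axialRotation (w * s) p + s • E4.basisVector 0)
    rw [radius_helix]; exact hp
  have htl : Kerr.bilin M a (γ s) (Kerr.drsrVector M a (γ s)) (Kerr.drsrVector M a (γ s)) < 0 :=
    Kerr.bilin_drsrVector_neg ha hrad
  have hne : Kerr.drsrVector M a (γ s) ≠ 0 := Kerr.drsrVector_ne_zero M a _
  refine ⟨hmd, ?_, ⟨?_, ?_⟩, ?_⟩
  · change Kerr.bilin M a (γ s) (velocity 𝓘(ℝ, E4) γ s) (velocity 𝓘(ℝ, E4) γ s) < 0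
    rw [hv]; exact htl
  · change Kerr.bilin M a (γ s) (velocity 𝓘(ℝ, E4) γ s) (velocity 𝓘(ℝ, E4) γ s) ≤ 0
    rw [hv]; exact htl.le
  · intro h; exact hne (hv.symm.trans h)
  · change Kerr.bilin M a (γ s) (Kerr.timeVector M a (γ s)) (velocity 𝓘(ℝ, E4) γ s) < 0
    rw [Kerr.bilin_timeVector hx, hv, Kerr.drsrVector_apply_zero]
    norm_num

end Summit.FinalStateConjecture.FinalStateConjecture.Cruxes.ModulatedKerrHandoff.SwallowTransfer

end
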